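import Literature.NumberTheory.Automorphic.UnitaryGroupCharpolyBorelClasses
import Literature.NumberTheory.Automorphic.UnitaryGroupCharpolyClassFinite
import HarnessLib

/-!
# The Borel refinement of a class map on `U(J_N)(F)`: splitting each `𝔬` into its part meeting a rational
# Borel and its part meeting none (Arthur's «`𝔬 ∩ P(F) = ∅` for every proper `P`» in `F`-rank one)
(Arthur, *A trace formula for reductive groups I*, Duke Math. J. 45 (1978), §8 and Thm. 8.1: the classes `𝔬`
such that no element of `𝔬` lies in a proper rational parabolic contribute orbital integrals; Rogawski,
*Automorphic Representations of Unitary Groups in Three Variables* (1990), §2.2–2.3 pp. 13–14 and §7.2 p. 91: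
in a SINGULAR elliptic stable class the rational classes `{γ}` with ANISOTROPIC centraliser `G_γ` contribute
`J^T_𝔬(f) = a(γ) m(𝐙G_γ∖𝐆_γ) Φ(γ, f)`, only the class of the singular element of `M` is treated by descent.)

Topic `NumberTheory/Automorphic`; namespace `Literature.NumberTheory.Automorphic.UnitaryGroup`. THEOREMS ONLY
over accepted tree modules: no definition, no named fact, no `sorry`, no instance, no notation. Item (L5-0b) of
the T1-qs road of `Cruxes/H413/Lines/F0_T1InnerFormTraceIdentity.lean` (cell `pub/hodgecm-mathlib`, crux H413).

WHY. The `𝔬`-expansion ★ `UnitaryGroupArthurKernelClassExpansion` and everything downstream (LAW 3, (3c), (3d),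
LAW 4: ★ `truncatedTraceClass_eq_mul_tsum_covol_mul_orbitalIntegral_cm`, ★ (L4-b)
`compactSpace_centralizer_quotient_of_forall_cl_ne`) hold for ANY class map `cl : G(F) → ι` with
`IsConjInvariant cl` and `IsUnipotentInvariantOnBorel cl`, and LAW 4 needs of a class `𝔬 = i` only that it MISSES
`B(F)` (`∀ β ∈ B(F), cl β ≠ i`). For the characteristic-polynomial class map of ★ `UnitaryGroupCharpolyClassMap`
(the STABLE semisimple classes) a singular class `(X − a)²(X − b)`, `a ≠ b ∈ E¹`, is MIXED (★
`UnitaryGroupCharpolyBorelClasses`, type (ii)): it contains the Borel class of `d(a,b,a)` AND the semisimple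
rational classes of the same stable class whose `a`-eigenplane is anisotropic, which meet no rational Borel. This
file refines an arbitrary class map by ONE BOOLEAN — «is `γ` conjugate under `G(F)` into `B(F)`» —

  `cl♭ γ := (cl γ, decide (∃ δ : G(F), δ γ δ⁻¹ ∈ B(F))) : ι × Bool`

(no definition is introduced: the theorems are about that lambda), so that the classes `(j, false)` miss
`B(F)` BY CONSTRUCTION (LAW 4 applies to every one of them: all elliptic rational classes, regular or singular),
and the classes `(j, true)` are the parts of the `cl`-classes that meet `B(F)` (for `N = 3` and
`cl = charpoly ∘ adelicVal`: exactly Arthur's three Borel families of ★ `meetsBorel_trichotomy`).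

* §1 **`isConjInvariant_borelRefine`**, **`isUnipotentInvariantOnBorel_borelRefine`** — `cl♭` inherits the two
  hypotheses of the expansion (`β n ∈ B(F)` for `β ∈ B(F)`, `n ∈ G(F) ∩ N(𝔸_F)`, ★
  `mem_arithmeticBorel_of_mem_adelicUnipotent`).
* §2 READINGS: `borelRefine_apply_of_mem_arithmeticBorel` (`cl♭ β = (cl β, true)` on `B(F)`),
  **`forall_borelRefine_ne_of_snd_eq_false`** (every class `(j, false)` misses `B(F)` — the `hi` of LAW 4,
  discharged), **`forall_borelRefine_ne_true_iff`** (`(j, true)` misses `B(F)` iff the `cl`-class `j` does),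
  `forall_arithmeticBorel_borelRefine_ne_iff`, the fibre readings `borelRefine_eq_true_iff` ∕
  `borelRefine_eq_false_iff`, and `exists_borelRefine_eq_true_iff` (the class `(j, true)` is non-empty iff
  `j` is the class of a rational Borel element).
* §3 FINITENESS: `finite_image_borelRefine_of_finite` (refining by `Bool` keeps finite images finite) and, for
  `cl = charpoly ∘ adelicVal`, **`finite_setOf_borelRefine_charpoly_of_isCompact`** with the two coverings
  `borelRefine_charpoly_mem_setOf_of_conj_mem` ∕ `…_of_conj_mul_mem` (from ★ C9
  `finite_setOf_charpoly_eq_of_isCompact`) — the finite index set `S♭_f` of the refined expansion.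

## References

* J. Arthur, *A trace formula for reductive groups I: terms associated to classes in `G(ℚ)`*, Duke Math. J. 45
  (1978), §8, Thm. 8.1 [Arthur1978TraceFormulaI].
* J. D. Rogawski, *Automorphic Representations of Unitary Groups in Three Variables*, Annals of Mathematics
  Studies 123 (1990), §2.2–2.3 (pp. 13–14), §7.2 (p. 91) [Rogawski1990].
-/

set_option autoImplicit false

noncomputable section

open NumberField IsDedekindDomain Matrix Polynomial
open scoped Classical MatrixGroups

namespace Literature.NumberTheory.Automorphic

namespace UnitaryGroup

variable {F E : Type} [Field F] [NumberField F] [Field E] [NumberField E] [Algebra F E]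
  {c : E ≃ₐ[F] E} {N : ℕ} {ι : Type*}

/-! ## §1 The refined class map inherits the two hypotheses of the expansion -/

/-- «`γ` is `G(F)`-conjugate into `B(F)`» is a conjugation-invariant property. [cite: Arthur1978TraceFormulaI, §8] -/
theorem exists_conj_mem_arithmeticBorel_iff_of_conj (γ δ : (quasiSplit F E c N).arithmeticSubgroup) :
    (∃ δ' : (quasiSplit F E c N).arithmeticSubgroup, δ' * (δ * γ * δ⁻¹) * δ'⁻¹ ∈ arithmeticBorel F E c N) ↔
      ∃ δ' : (quasiSplit F E c N).arithmeticSubgroup, δ' * γ * δ'⁻¹ ∈ arithmeticBorel F E c N := by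
  constructor
  · rintro ⟨δ', h⟩
    refine ⟨δ' * δ, ?_⟩
    have hrw : δ' * δ * γ * (δ' * δ)⁻¹ = δ' * (δ * γ * δ⁻¹) * δ'⁻¹ := by group
    rwa [hrw]
  · rintro ⟨δ', h⟩
    refine ⟨δ' * δ⁻¹, ?_⟩
    have hrw : δ' * δ⁻¹ * (δ * γ * δ⁻¹) * (δ' * δ⁻¹)⁻¹ = δ' * γ * δ'⁻¹ := by group
    rwa [hrw]

/-- **`cl♭` IS CONJUGATION-INVARIANT** when `cl` is: the hypothesis `IsConjInvariant` of ★
`UnitaryGroupArthurKernelClassExpansion` for the Borel refinement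
`cl♭ γ = (cl γ, decide (∃ δ ∈ G(F), δ γ δ⁻¹ ∈ B(F)))`. [cite: Arthur1978TraceFormulaI, §8]
[cite: Rogawski1990, §2.2 (p. 13)] -/
theorem isConjInvariant_borelRefine {cl : (quasiSplit F E c N).arithmeticSubgroup → ι} (hcl : IsConjInvariant cl) :
    IsConjInvariant (fun γ : (quasiSplit F E c N).arithmeticSubgroup =>
      (cl γ, decide (∃ δ : (quasiSplit F E c N).arithmeticSubgroup, δ * γ * δ⁻¹ ∈ arithmeticBorel F E c N))) := by
  intro γ δ
  simp only [Prod.mk.injEq]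
  exact ⟨hcl γ δ, (decide_eq_decide.2 (exists_conj_mem_arithmeticBorel_iff_of_conj γ δ))⟩

/-- A rational Borel element is (trivially) conjugate into `B(F)`. [cite: Rogawski1990, §2.2 (p. 13)] -/
theorem exists_conj_mem_arithmeticBorel_of_mem {β : (quasiSplit F E c N).arithmeticSubgroup}
    (hβ : β ∈ arithmeticBorel F E c N) :
    ∃ δ : (quasiSplit F E c N).arithmeticSubgroup, δ * β * δ⁻¹ ∈ arithmeticBorel F E c N :=
  ⟨1, by simpa only [one_mul, inv_one, mul_one] using hβ⟩

/-- **`cl♭` IS `N(F)`-SATURATED ON THE RATIONAL BOREL** when `cl` is: for `β ∈ B(F)` and `n ∈ G(F) ∩ N(𝔸_F)`,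
`β n ∈ B(F)` (★ `mem_arithmeticBorel_of_mem_adelicUnipotent`), so both `β` and `β n` carry the flag `true`
— the hypothesis `IsUnipotentInvariantOnBorel` of ★ `UnitaryGroupArthurKernelClassExpansion` for the Borel
refinement. [cite: Rogawski1990, §2.2 (p. 13)] -/
theorem isUnipotentInvariantOnBorel_borelRefine {cl : (quasiSplit F E c N).arithmeticSubgroup → ι}
    (hclN : IsUnipotentInvariantOnBorel F E c N cl) :
    IsUnipotentInvariantOnBorel F E c N (fun γ : (quasiSplit F E c N).arithmeticSubgroup =>
      (cl γ, decide (∃ δ : (quasiSplit F E c N).arithmeticSubgroup, δ * γ * δ⁻¹ ∈ arithmeticBorel F E c N))) := by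
  intro β n hβ hn
  simp only [Prod.mk.injEq]
  refine ⟨hclN β n hβ hn, decide_eq_decide.2 ⟨fun _ => exists_conj_mem_arithmeticBorel_of_mem hβ, fun _ => ?_⟩⟩
  exact exists_conj_mem_arithmeticBorel_of_mem (mul_mem hβ (mem_arithmeticBorel_of_mem_adelicUnipotent hn))

/-! ## §2 Readings of the refined classes -/

/-- On the rational Borel the refined class is `(cl β, true)`. [cite: Rogawski1990, §2.2 (p. 13)] -/
theorem borelRefine_apply_of_mem_arithmeticBorel (cl : (quasiSplit F E c N).arithmeticSubgroup → ι)
    {β : (quasiSplit F E c N).arithmeticSubgroup} (hβ : β ∈ arithmeticBorel F E c N) :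
    (fun γ : (quasiSplit F E c N).arithmeticSubgroup =>
      (cl γ, decide (∃ δ : (quasiSplit F E c N).arithmeticSubgroup, δ * γ * δ⁻¹ ∈ arithmeticBorel F E c N))) β =
      (cl β, true) := by
  change (cl β, decide (∃ δ : (quasiSplit F E c N).arithmeticSubgroup, δ * β * δ⁻¹ ∈ arithmeticBorel F E c N)) =
    (cl β, true)
  rw [decide_eq_true (exists_conj_mem_arithmeticBorel_of_mem hβ)]

/-- **EVERY CLASS `(j, false)` MISSES `B(F)`** — the hypothesis `hi : ∀ β ∈ B(F), cl♭ β ≠ i` of LAW 4 (★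
`truncatedTraceClass_eq_mul_tsum_covol_mul_orbitalIntegral_cm`, ★ `compactSpace_centralizer_quotient_of_forall_cl_ne`)
holds for every refined class with flag `false`, with no hypothesis on `cl` or `j`: these classes consist of
rational elements none of whose `G(F)`-conjugates lies in `B(F)` (Arthur's «`𝔬 ∩ P(F) = ∅`», rank one).
[cite: Arthur1978TraceFormulaI, §8] [cite: Rogawski1990, §2.2–2.3 (pp. 13–14)] -/
theorem forall_borelRefine_ne_of_snd_eq_false (cl : (quasiSplit F E c N).arithmeticSubgroup → ι) (j : ι) :
    ∀ β : arithmeticBorel F E c N,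
      (fun γ : (quasiSplit F E c N).arithmeticSubgroup =>
        (cl γ, decide (∃ δ : (quasiSplit F E c N).arithmeticSubgroup, δ * γ * δ⁻¹ ∈ arithmeticBorel F E c N))) β ≠
      (j, false) := by
  intro β h
  rw [borelRefine_apply_of_mem_arithmeticBorel cl β.2, Prod.mk.injEq] at h
  exact Bool.noConfusion h.2

/-- **A class `(j, true)` misses `B(F)` iff the `cl`-class `j` does.** [cite: Rogawski1990, §2.2–2.3 (pp. 13–14)] -/
theorem forall_borelRefine_ne_true_iff (cl : (quasiSplit F E c N).arithmeticSubgroup → ι) (j : ι) :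
    (∀ β : arithmeticBorel F E c N,
      (fun γ : (quasiSplit F E c N).arithmeticSubgroup =>
        (cl γ, decide (∃ δ : (quasiSplit F E c N).arithmeticSubgroup, δ * γ * δ⁻¹ ∈ arithmeticBorel F E c N))) β ≠
      (j, true)) ↔
    ∀ β : arithmeticBorel F E c N, cl β ≠ j := by
  refine forall_congr' fun β => ?_
  rw [borelRefine_apply_of_mem_arithmeticBorel cl β.2, Ne, Ne, Prod.mk.injEq]
  simp only [and_true]

/-- The `B(F)`-missing predicate of the two ★ sums (★ `arthurTrace_eq_sum_offBorel_add_sum_charpoly_cm`, ★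
`arthurTrace_eq_sum_orbital_add_sum_charpoly_cm`) for a refined class `i`: it holds iff `i.2 = false` or the
`cl`-class `i.1` misses `B(F)`. [cite: Rogawski1990, §2.2–2.3 (pp. 13–14)] -/
theorem forall_arithmeticBorel_borelRefine_ne_iff (cl : (quasiSplit F E c N).arithmeticSubgroup → ι) (i : ι × Bool) :
    (∀ β : arithmeticBorel F E c N,
      (fun γ : (quasiSplit F E c N).arithmeticSubgroup =>
        (cl γ, decide (∃ δ : (quasiSplit F E c N).arithmeticSubgroup, δ * γ * δ⁻¹ ∈ arithmeticBorel F E c N))) β ≠ i) ↔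
    i.2 = false ∨ ∀ β : arithmeticBorel F E c N, cl β ≠ i.1 := by
  obtain ⟨j, b⟩ := i
  cases b
  · simp only [true_or, iff_true]
    exact forall_borelRefine_ne_of_snd_eq_false cl j
  · rw [forall_borelRefine_ne_true_iff]
    simp only [Bool.true_eq_false, false_or]

/-- **Fibre reading, flag `true`**: `cl♭ γ = (j, true)` iff `cl γ = j` and SOME `G(F)`-conjugate of `γ` lies in
`B(F)`. [cite: Arthur1978TraceFormulaI, §8] -/
theorem borelRefine_eq_true_iff (cl : (quasiSplit F E c N).arithmeticSubgroup → ι)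
    (γ : (quasiSplit F E c N).arithmeticSubgroup) (j : ι) :
    (fun γ : (quasiSplit F E c N).arithmeticSubgroup =>
        (cl γ, decide (∃ δ : (quasiSplit F E c N).arithmeticSubgroup, δ * γ * δ⁻¹ ∈ arithmeticBorel F E c N))) γ =
      (j, true) ↔
    cl γ = j ∧ ∃ δ : (quasiSplit F E c N).arithmeticSubgroup, δ * γ * δ⁻¹ ∈ arithmeticBorel F E c N := by
  simp only [Prod.mk.injEq, decide_eq_true_eq]

/-- **Fibre reading, flag `false`**: `cl♭ γ = (j, false)` iff `cl γ = j` and NO `G(F)`-conjugate of `γ` lies in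
`B(F)` (`γ` is elliptic in Arthur's sense). [cite: Arthur1978TraceFormulaI, §8] -/
theorem borelRefine_eq_false_iff (cl : (quasiSplit F E c N).arithmeticSubgroup → ι)
    (γ : (quasiSplit F E c N).arithmeticSubgroup) (j : ι) :
    (fun γ : (quasiSplit F E c N).arithmeticSubgroup =>
        (cl γ, decide (∃ δ : (quasiSplit F E c N).arithmeticSubgroup, δ * γ * δ⁻¹ ∈ arithmeticBorel F E c N))) γ =
      (j, false) ↔
    cl γ = j ∧ ∀ δ : (quasiSplit F E c N).arithmeticSubgroup, δ * γ * δ⁻¹ ∉ arithmeticBorel F E c N := by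
  simp only [Prod.mk.injEq, decide_eq_false_iff_not, not_exists]

/-- **The class `(j, true)` is non-empty iff `j` is the class of a rational BOREL element** (for a
conjugation-invariant `cl`): the flag-`true` classes are indexed by the `cl`-classes meeting `B(F)` — for
`N = 3`, `cl = charpoly ∘ adelicVal`, by the trichotomy of ★ `UnitaryGroupCharpolyBorelClasses`.
[cite: Rogawski1990, §2.2–2.3 (pp. 13–14)] -/
theorem exists_borelRefine_eq_true_iff {cl : (quasiSplit F E c N).arithmeticSubgroup → ι} (hcl : IsConjInvariant cl)
    (j : ι) :
    (∃ γ : (quasiSplit F E c N).arithmeticSubgroup,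
      (fun γ : (quasiSplit F E c N).arithmeticSubgroup =>
        (cl γ, decide (∃ δ : (quasiSplit F E c N).arithmeticSubgroup, δ * γ * δ⁻¹ ∈ arithmeticBorel F E c N))) γ =
      (j, true)) ↔
    ∃ β : arithmeticBorel F E c N, cl β = j := by
  constructor
  · rintro ⟨γ, hγ⟩
    obtain ⟨hj, δ, hδ⟩ := (borelRefine_eq_true_iff cl γ j).1 hγ
    exact ⟨⟨δ * γ * δ⁻¹, hδ⟩, by rw [← hj]; exact hcl γ δ⟩
  · rintro ⟨β, hβ⟩
    exact ⟨β, (borelRefine_eq_true_iff cl β j).2 ⟨hβ, exists_conj_mem_arithmeticBorel_of_mem β.2⟩⟩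

/-- The first coordinate of `cl♭` is `cl` (so each `cl`-class is the disjoint union of its two refined parts).
[cite: Arthur1978TraceFormulaI, §8] -/
theorem fst_borelRefine (cl : (quasiSplit F E c N).arithmeticSubgroup → ι) (γ : (quasiSplit F E c N).arithmeticSubgroup) :
    ((fun γ : (quasiSplit F E c N).arithmeticSubgroup =>
        (cl γ, decide (∃ δ : (quasiSplit F E c N).arithmeticSubgroup, δ * γ * δ⁻¹ ∈ arithmeticBorel F E c N))) γ).1 =
      cl γ := rfl

/-! ## §3 Finiteness of the refined classes meeting a compact set -/

/-- **Refining by a Boolean keeps finite images finite**: `cl♭ '' A ⊆ (cl '' A) ×ˢ univ` — so «only finitely many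
classes meet a compact set» passes from `cl` to `cl♭`. [cite: Arthur1978TraceFormulaI, §5] [cite: Rogawski1990, §2.2 (p. 13)] -/
theorem finite_image_borelRefine_of_finite (cl : (quasiSplit F E c N).arithmeticSubgroup → ι)
    {A : Set (quasiSplit F E c N).arithmeticSubgroup} (h : (cl '' A).Finite) :
    ((fun γ : (quasiSplit F E c N).arithmeticSubgroup =>
        (cl γ, decide (∃ δ : (quasiSplit F E c N).arithmeticSubgroup, δ * γ * δ⁻¹ ∈ arithmeticBorel F E c N))) '' A).Finite := by
  refine (h.prod (Set.finite_univ : (Set.univ : Set Bool).Finite)).subset ?_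
  rintro _ ⟨γ, hγ, rfl⟩
  exact ⟨⟨γ, hγ, rfl⟩, Set.mem_univ _⟩

/-- **THE FINITE INDEX SET `S♭_f` OF THE REFINED EXPANSION** (for `cl = charpoly ∘ adelicVal`): the refined
classes `(charpoly (adelicVal γ), flag γ)` of the rational `γ` whose characteristic polynomial is a characteristic
polynomial on the compact `C` form a finite set — they lie in ★ C9's finite set
`finite_setOf_charpoly_eq_of_isCompact` times `Bool`. [cite: Rogawski1990, §2.2 (p. 13)]
[cite: Arthur1978TraceFormulaI, §5] -/
theorem finite_setOf_borelRefine_charpoly_of_isCompact {C : Set (quasiSplit F E c N).Adelic} (hC : IsCompact C) :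
    {i : (AdeleRing (𝓞 E) E)[X] × Bool |
        (∃ γ : (quasiSplit F E c N).arithmeticSubgroup,
          (fun γ : (quasiSplit F E c N).arithmeticSubgroup =>
            (((adelicVal F E c N _ (γ : (quasiSplit F E c N).Adelic) : GL (Fin N) (AdeleRing (𝓞 E) E)) :
                Matrix (Fin N) (Fin N) (AdeleRing (𝓞 E) E)).charpoly,
              decide (∃ δ : (quasiSplit F E c N).arithmeticSubgroup, δ * γ * δ⁻¹ ∈ arithmeticBorel F E c N))) γ = i) ∧
        ∃ g ∈ C, ((adelicVal F E c N _ g : GL (Fin N) (AdeleRing (𝓞 E) E)) :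
            Matrix (Fin N) (Fin N) (AdeleRing (𝓞 E) E)).charpoly = i.1}.Finite := by
  refine ((finite_setOf_charpoly_eq_of_isCompact (F := F) (E := E) (c := c) (N := N) hC).prod
    (Set.finite_univ : (Set.univ : Set Bool).Finite)).subset ?_
  rintro ⟨p, b⟩ ⟨⟨γ, hγ⟩, g, hg, hgp⟩
  refine ⟨⟨⟨γ, ?_⟩, g, hg, hgp⟩, Set.mem_univ _⟩
  have h1 := congrArg Prod.fst hγ
  exact h1

/-- **The `K`-side covering for `S♭_f`**: if a conjugate `x⁻¹ γ x` of the rational `γ` lies in `C`, the refined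
class of `γ` is in the finite set of `finite_setOf_borelRefine_charpoly_of_isCompact` (★ `charpoly_adelicVal_conj`).
[cite: Rogawski1990, §2.2 (p. 13)] -/
theorem borelRefine_charpoly_mem_setOf_of_conj_mem {C : Set (quasiSplit F E c N).Adelic}
    {γ : (quasiSplit F E c N).arithmeticSubgroup} {x : (quasiSplit F E c N).Adelic}
    (h : x⁻¹ * (γ : (quasiSplit F E c N).Adelic) * x ∈ C) :
    (fun γ : (quasiSplit F E c N).arithmeticSubgroup =>
        (((adelicVal F E c N _ (γ : (quasiSplit F E c N).Adelic) : GL (Fin N) (AdeleRing (𝓞 E) E)) :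
            Matrix (Fin N) (Fin N) (AdeleRing (𝓞 E) E)).charpoly,
          decide (∃ δ : (quasiSplit F E c N).arithmeticSubgroup, δ * γ * δ⁻¹ ∈ arithmeticBorel F E c N))) γ ∈
      {i : (AdeleRing (𝓞 E) E)[X] × Bool |
        (∃ γ : (quasiSplit F E c N).arithmeticSubgroup,
          (fun γ : (quasiSplit F E c N).arithmeticSubgroup =>
            (((adelicVal F E c N _ (γ : (quasiSplit F E c N).Adelic) : GL (Fin N) (AdeleRing (𝓞 E) E)) :
                Matrix (Fin N) (Fin N) (AdeleRing (𝓞 E) E)).charpoly,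
              decide (∃ δ : (quasiSplit F E c N).arithmeticSubgroup, δ * γ * δ⁻¹ ∈ arithmeticBorel F E c N))) γ = i) ∧
        ∃ g ∈ C, ((adelicVal F E c N _ g : GL (Fin N) (AdeleRing (𝓞 E) E)) :
            Matrix (Fin N) (Fin N) (AdeleRing (𝓞 E) E)).charpoly = i.1} :=
  ⟨⟨γ, rfl⟩, _, h, charpoly_adelicVal_conj _ _⟩

/-- **The `K_B`-side covering for `S♭_f`**: if `y⁻¹ (β u) y ∈ C` for a rational Borel `β ∈ B(F)`, an adelic
unipotent `u ∈ N(𝔸_F)` and `y ∈ G(𝔸_F)`, the refined class of `β` is in the finite set of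
`finite_setOf_borelRefine_charpoly_of_isCompact` (★ `charpoly_adelicVal_mem_setOf_of_conj_mul_mem`).
[cite: Rogawski1990, §2.2 (p. 13)] -/
theorem borelRefine_charpoly_mem_setOf_of_conj_mul_mem {C : Set (quasiSplit F E c N).Adelic}
    {β : (quasiSplit F E c N).arithmeticSubgroup} (hβ : β ∈ arithmeticBorel F E c N)
    {u : (quasiSplit F E c N).Adelic} (hu : u ∈ adelicUnipotent F E c N) {y : (quasiSplit F E c N).Adelic}
    (h : y⁻¹ * (β : (quasiSplit F E c N).Adelic) * (u * y) ∈ C) :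
    (fun γ : (quasiSplit F E c N).arithmeticSubgroup =>
        (((adelicVal F E c N _ (γ : (quasiSplit F E c N).Adelic) : GL (Fin N) (AdeleRing (𝓞 E) E)) :
            Matrix (Fin N) (Fin N) (AdeleRing (𝓞 E) E)).charpoly,
          decide (∃ δ : (quasiSplit F E c N).arithmeticSubgroup, δ * γ * δ⁻¹ ∈ arithmeticBorel F E c N))) β ∈
      {i : (AdeleRing (𝓞 E) E)[X] × Bool |
        (∃ γ : (quasiSplit F E c N).arithmeticSubgroup,
          (fun γ : (quasiSplit F E c N).arithmeticSubgroup =>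
            (((adelicVal F E c N _ (γ : (quasiSplit F E c N).Adelic) : GL (Fin N) (AdeleRing (𝓞 E) E)) :
                Matrix (Fin N) (Fin N) (AdeleRing (𝓞 E) E)).charpoly,
              decide (∃ δ : (quasiSplit F E c N).arithmeticSubgroup, δ * γ * δ⁻¹ ∈ arithmeticBorel F E c N))) γ = i) ∧
        ∃ g ∈ C, ((adelicVal F E c N _ g : GL (Fin N) (AdeleRing (𝓞 E) E)) :
            Matrix (Fin N) (Fin N) (AdeleRing (𝓞 E) E)).charpoly = i.1} := by
  obtain ⟨-, g, hg, hgp⟩ := charpoly_adelicVal_mem_setOf_of_conj_mul_mem (F := F) (c := c) hβ hu h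
  exact ⟨⟨β, rfl⟩, g, hg, hgp⟩

/-! ## §4 `N = 3`: the flag-`true` classes of the refined characteristic-polynomial map are indexed by the
Borel characteristic polynomials -/

/-- **For `cl = charpoly ∘ adelicVal` on `U(J₃)` (`c² = 1`), the class `(i, true)` is non-empty iff
`i = ((X − a)(X − b)(X − (c a)⁻¹)).map (E → 𝔸_E)` for some `a ∈ Eˣ`, `b ∈ E¹`** — so the flag-`true` classes
are exactly Arthur's Borel families of ★ `meetsBorel_trichotomy` (central × unipotent ∕ singular `d(a,b,a)` ∕
regular hyperbolic), each now separated from the elliptic rational classes of the same stable class.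
[cite: Rogawski1990, §2.2–2.3 (pp. 13–14); §7.2 (p. 91)] -/
theorem exists_borelRefine_charpoly_eq_true_iff (hc : c * c = 1) (i : (AdeleRing (𝓞 E) E)[X]) :
    (∃ γ : (quasiSplit F E c 3).arithmeticSubgroup,
      (fun γ : (quasiSplit F E c 3).arithmeticSubgroup =>
        (((adelicVal F E c 3 _ (γ : (quasiSplit F E c 3).Adelic) : GL (Fin 3) (AdeleRing (𝓞 E) E)) :
            Matrix (Fin 3) (Fin 3) (AdeleRing (𝓞 E) E)).charpoly,
          decide (∃ δ : (quasiSplit F E c 3).arithmeticSubgroup, δ * γ * δ⁻¹ ∈ arithmeticBorel F E c 3))) γ =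
        (i, true)) ↔
    ∃ a b : Eˣ, c (b : E) * (b : E) = 1 ∧
      i = ((X - C (a : E)) * (X - C (b : E)) * (X - C (c (a : E))⁻¹)).map (algebraMap E (AdeleRing (𝓞 E) E)) := by
  rw [exists_borelRefine_eq_true_iff isConjInvariant_charpoly_adelicVal, ← exists_arithmeticBorel_charpoly_eq_iff hc i]

end UnitaryGroup

end Literature.NumberTheory.Automorphic
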